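import Literature.Topology.FourManifolds.InteriorDiscs
import Literature.Topology.FourManifolds.CircleFramingWalk
import Mathlib.Analysis.Convex.Topology
import HarnessLib

/-!
# Orientability is decided on the interior: extending an orientation of the interior

Topic `Literature/Topology/FourManifolds` (general differential topology).  Let `M` be a `C^∞`
manifold on a real model `I : ModelWithCorners ℝ E H` whose range is **convex** (the half-space
`𝓡∂ n`, quadrants, all boundaryless models), and let
`InteriorManifold I M` be its boundaryless interior (`InteriorManifold.lean`).  The tree has the
restriction of a smooth orientation of `M` to the interior (`SmoothOrientation.interior`,
`InteriorDiscs.lean`); here we prove the converse: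

* `InteriorOrientation.extend` — **an orientation `o` of the interior extends to a smooth
  orientation of `M`** agreeing with `o` at interior points (`extend_apply_of_isInteriorPoint`,
  `interior_extend`);
* `isOrientable_iff_interiorManifold` — **`M` is orientable iff its interior is**;
* `IsOrientable.of_interiorManifold_euclideanHalfSpace` — the half-space case `𝓡∂ n`.

This is the bookkeeping behind "orientability of a manifold with boundary is a property of its
interior" (Hirsch, *Differential Topology* (1976), §4.4: orientations as coherent families of
orientations of tangent spaces; an orientation is determined on any dense open set meeting every
component in a connected set).  Written for the fact seat of (g′)
`exists_marking_centralSurface_of_gkTrisection` (`TrisectionFunctorGK.lean`): the handlebodies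
`H_{ij}` of a Gay–Kirby trisection are shown orientable through their interiors, which embed as
open subsets of the (orientable) boundaries of the sectors.

## Construction

In the tree's formalism (`SmoothOrientation`: a family `p ↦ o p` of orientations of `E`,
locally constant in the sense "`o y = o p` iff the chart change `y → p` has positive Jacobian at
`y`") the value at a boundary point `p` is forced: the interior points of a small chart ball
about `p` (`InteriorOrientation.nbhd`) form a **preconnected** set (the image of the convex set
`ball ∩ interior (range I)`, `isPreconnected_nbhd`) which is **non-empty** (`nbhd_nonempty`:
the range of a model with corners lies in the closure of its interior, Mathlib's
`ModelWithCorners.range_subset_closure_interior`), on which the test "`o y = w` iff the chart change `y → p` is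
positive at `y`" against a reference orientation `w` is locally constant
(`eventually_agrees_iff`, from the axiom of `o` and the cocycle of chart changes) hence constant
(`agrees_iff_of_isPreconnected`); `extendFun` picks `±w` accordingly.  The key property
`apply_eq_extendFun_iff` (for every `p` and every interior `y` in the chart ball of `p`:
`o y = extendFun p` iff the chart change `y → p` is positive at `y`) then gives local constancy
of the extension at every point by passing through a common nearby interior point and the
cocycle (`extend`).  Helper sign bookkeeping comes from `CircleFramingWalk.lean`
(`eventually_det_tangentCoordChange_pos_iff`, `det_tangentCoordChange_pos_iff_of_mem`).
Everything is proved; there are no named facts.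

## References

* M. W. Hirsch, *Differential Topology*, GTM 33 (1976), §4.4 (orientations, pp. 101–104).
  [HirschDT1976]
* T. Bröcker, K. Jänich, *Introduction to Differential Topology*, CUP (1982), (13.3) (the
  interior of a manifold with boundary). [BrockerJanich1982]
-/

open scoped Manifold ContDiff Topology
open Set Function Filter Module

noncomputable section

namespace Literature.Topology.FourManifolds

namespace InteriorOrientation

variable {E H : Type*} [NormedAddCommGroup E] [NormedSpace ℝ E]
  [TopologicalSpace H] {I : ModelWithCorners ℝ E H}
  {M : Type*} [TopologicalSpace M] [ChartedSpace H M] [IsManifold I ∞ M]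

open InteriorManifold CircleFraming

/-- Local notation: the Jacobian sign test. -/
local notation "Dpos" I' ";" a ";" b ";" c =>
  (0 : ℝ) < LinearMap.det ((tangentCoordChange I' a b c : E →L[ℝ] E) : E →ₗ[ℝ] E)

/-- The local-constancy axiom of an orientation of the interior manifold, read through the
tangent coordinate changes of `M` (`InteriorManifold.tangentCoordChange_eq`). [folklore] -/
theorem eventually_eq_iff_val (o : SmoothOrientation 𝓘(ℝ, E) (InteriorManifold I M))
    (y₀ : InteriorManifold I M) :
    ∀ᶠ y in 𝓝 y₀, (o y = o y₀ ↔ (Dpos I ; y.val ; y₀.val ; y.val)) := by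
  filter_upwards [o.eventually_eq_iff y₀] with y hy
  rwa [InteriorManifold.tangentCoordChange_eq y y₀ y (mem_extChartAt_source y)] at hy

/-- The agreement test of an orientation `o` of the interior, at an interior point `y` of the
chart domain of `p : M`, against a reference orientation `w` placed at `p`: "`o y = w` iff the
chart change `y → p` has positive Jacobian at `y`". [folklore] -/
def Agrees (o : SmoothOrientation 𝓘(ℝ, E) (InteriorManifold I M))
    (w : Orientation ℝ E (Fin (finrank ℝ E))) (p : M) (y : InteriorManifold I M) : Prop :=
  o y = w ↔ (Dpos I ; y.val ; p ; y.val)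

/-- **The agreement test is locally constant** on the interior points of the chart domain of
`p`. [folklore] -/
theorem eventually_agrees_iff [FiniteDimensional ℝ E]
    (o : SmoothOrientation 𝓘(ℝ, E) (InteriorManifold I M))
    (w : Orientation ℝ E (Fin (finrank ℝ E))) {p : M} {y₀ : InteriorManifold I M}
    (h : y₀.val ∈ (chartAt H p).source) :
    ∀ᶠ y in 𝓝 y₀, (Agrees o w p y ↔ Agrees o w p y₀) := by
  have h1 := eventually_eq_iff_val o y₀
  have h2 : ∀ᶠ y : InteriorManifold I M in 𝓝 y₀,
      ((Dpos I ; y₀.val ; p ; y.val) ↔ (Dpos I ; y₀.val ; p ; y₀.val)) :=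
    continuous_val.continuousAt.eventually (eventually_det_tangentCoordChange_pos_iff (I := I) h)
  have h3 : ∀ᶠ y : InteriorManifold I M in 𝓝 y₀, y.val ∈ (chartAt H p).source :=
    continuous_val.continuousAt.preimage_mem_nhds ((chartAt H p).open_source.mem_nhds h)
  have h4 : ∀ᶠ y : InteriorManifold I M in 𝓝 y₀, y.val ∈ (chartAt H y₀.val).source :=
    continuous_val.continuousAt.preimage_mem_nhds
      ((chartAt H y₀.val).open_source.mem_nhds (mem_chart_source H y₀.val))
  filter_upwards [h1, h2, h3, h4] with y hy1 hy2 hy3 hy4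
  have hyp : y.val ∈ (extChartAt I p).source := by rwa [_root_.extChartAt_source]
  have hyy₀ : y.val ∈ (extChartAt I y₀.val).source := by rwa [_root_.extChartAt_source]
  have hdet := det_tangentCoordChange_pos_iff_of_mem (mem_extChartAt_source y.val) hyy₀ hyp
  unfold Agrees
  have htri := orientation_eq_iff_eq_iff_eq (o y) w (o y₀)
  tauto

/-- **The agreement test is constant along preconnected sets of interior points of a chart
domain** (clopen argument). [folklore] -/
theorem agrees_iff_of_isPreconnected [FiniteDimensional ℝ E]
    (o : SmoothOrientation 𝓘(ℝ, E) (InteriorManifold I M))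
    (w : Orientation ℝ E (Fin (finrank ℝ E))) {p : M} {S : Set (InteriorManifold I M)}
    (hS : IsPreconnected S) (hSU : ∀ y ∈ S, y.val ∈ (chartAt H p).source)
    {y y' : InteriorManifold I M} (hy : y ∈ S) (hy' : y' ∈ S) :
    Agrees o w p y ↔ Agrees o w p y' := by
  let U : Set (InteriorManifold I M) := {z | z.val ∈ (chartAt H p).source}
  have hopen : ∀ T : Set (InteriorManifold I M),
      (∀ z₀ ∈ U, ∀ᶠ z in 𝓝 z₀, (z ∈ T ↔ z₀ ∈ T)) → IsOpen (U ∩ T) := by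
    intro T hT
    rw [isOpen_iff_mem_nhds]
    rintro z₀ ⟨hz₀U, hz₀T⟩
    have hU : U ∈ 𝓝 z₀ :=
      continuous_val.continuousAt.preimage_mem_nhds ((chartAt H p).open_source.mem_nhds hz₀U)
    filter_upwards [hU, hT z₀ hz₀U] with z hzU hz
    exact ⟨hzU, hz.2 hz₀T⟩
  let T : Set (InteriorManifold I M) := {z | Agrees o w p z}
  have hA : IsOpen (U ∩ T) := hopen T fun z₀ hz₀ => eventually_agrees_iff o w hz₀
  have hB : IsOpen (U ∩ Tᶜ) := hopen Tᶜ fun z₀ hz₀ => by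
    filter_upwards [eventually_agrees_iff o w hz₀] with z hz
    exact not_congr hz
  by_contra hne
  -- one of `y`, `y'` agrees and the other does not
  have key : ∀ {a b : InteriorManifold I M}, a ∈ S → b ∈ S → Agrees o w p a → ¬ Agrees o w p b →
      False := by
    intro a b ha hb hA' hB'
    have hcov : S ⊆ (U ∩ T) ∪ (U ∩ Tᶜ) := fun z hz => by
      by_cases h : Agrees o w p z
      · exact Or.inl ⟨hSU z hz, h⟩
      · exact Or.inr ⟨hSU z hz, h⟩
    obtain ⟨z, -, ⟨-, hzT⟩, ⟨-, hzT'⟩⟩ :=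
      hS _ _ hA hB hcov ⟨a, ha, hSU a ha, hA'⟩ ⟨b, hb, hSU b hb, hB'⟩
    exact hzT' hzT
  by_cases h : Agrees o w p y
  · exact key hy hy' h (fun h' => hne ⟨fun _ => h', fun _ => h⟩)
  · exact key hy' hy (by tauto) h

/-! #### Chart-ball neighbourhoods of a point, and their interior parts -/

/-- The interior points of the chart domain of `p` whose chart value lies in the `ε`-ball about
the chart value of `p`. [folklore] -/
def nbhd (p : M) (ε : ℝ) : Set (InteriorManifold I M) :=
  {y | y.val ∈ (chartAt H p).source ∧ extChartAt I p y.val ∈ Metric.ball (extChartAt I p p) ε}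

omit [IsManifold I ∞ M] in
/-- Membership in `nbhd`. [folklore] -/
theorem mem_nbhd_iff {p : M} {ε : ℝ} {y : InteriorManifold I M} :
    y ∈ nbhd p ε ↔ y.val ∈ (chartAt H p).source ∧
      extChartAt I p y.val ∈ Metric.ball (extChartAt I p p) ε :=
  Iff.rfl

omit [IsManifold I ∞ M] in
/-- **Small chart balls**: for every `p` there is `ε > 0` such that the points of `range I` within
`ε` of the chart value of `p` lie in the chart target. [folklore] -/
theorem exists_ball_inter_range_subset_target (p : M) :
    ∃ ε > 0, Metric.ball (extChartAt I p p) ε ∩ range I ⊆ (extChartAt I p).target := by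
  have h := extChartAt_target_mem_nhdsWithin (I := I) p
  rw [Metric.mem_nhdsWithin_iff] at h
  exact h

/-- The chart model of the interior part of a chart ball: the convex set
`ball ∩ interior (range I)`. [folklore] -/
def modelSet (p : M) (ε : ℝ) : Set E := Metric.ball (extChartAt I p p) ε ∩ interior (range I)

/-- Points of the model set are chart values of interior points. [folklore] -/
theorem isInteriorPoint_symm_of_mem_modelSet {p : M} {ε : ℝ}
    (hε : Metric.ball (extChartAt I p p) ε ∩ range I ⊆ (extChartAt I p).target) {u : E}
    (hu : u ∈ modelSet (I := I) p ε) : I.IsInteriorPoint ((extChartAt I p).symm u) := by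
  have hut : u ∈ (extChartAt I p).target := hε ⟨hu.1, interior_subset hu.2⟩
  rw [_root_.extChartAt_target] at hut
  exact isInteriorPoint_extend_symm (chart_mem_atlas H p) ⟨hut.1, hu.2⟩

/-- The parametrisation of the interior part of a chart ball by its model set. [folklore] -/
def param {p : M} {ε : ℝ}
    (hε : Metric.ball (extChartAt I p p) ε ∩ range I ⊆ (extChartAt I p).target) :
    ↥(modelSet (I := I) p ε) → InteriorManifold I M :=
  InteriorManifold.lift (fun u => (extChartAt I p).symm u.1)
    fun u => isInteriorPoint_symm_of_mem_modelSet hε u.2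

/-- The parametrisation is continuous. [folklore] -/
theorem continuous_param {p : M} {ε : ℝ}
    (hε : Metric.ball (extChartAt I p p) ε ∩ range I ⊆ (extChartAt I p).target) :
    Continuous (param (I := I) hε) := by
  rw [param, continuous_iff_comp_val, val_comp_lift]
  refine (continuousOn_extChartAt_symm p).comp_continuous continuous_subtype_val fun u => ?_
  exact hε ⟨u.2.1, interior_subset u.2.2⟩

/-- **The interior part of a small chart ball is the image of its (convex) model set.**
[folklore] -/
theorem nbhd_eq_range_param {p : M} {ε : ℝ}
    (hε : Metric.ball (extChartAt I p p) ε ∩ range I ⊆ (extChartAt I p).target) :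
    nbhd (I := I) p ε = range (param (I := I) hε) := by
  ext y
  constructor
  · rintro ⟨hys, hyb⟩
    have hint : extChartAt I p y.val ∈ interior (range I) := by
      rw [extChartAt]
      exact extend_mem_interior_range (chart_mem_atlas H p) hys y.property
    refine ⟨⟨extChartAt I p y.val, hyb, hint⟩, ?_⟩
    apply val_injective
    rw [param, ← Function.comp_apply (f := val), val_comp_lift]
    exact (extChartAt I p).left_inv (by rwa [_root_.extChartAt_source])
  · rintro ⟨u, rfl⟩
    have hut : u.1 ∈ (extChartAt I p).target := hε ⟨u.2.1, interior_subset u.2.2⟩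
    have hval : (param (I := I) hε u).val = (extChartAt I p).symm u.1 := by
      rw [param, ← Function.comp_apply (f := val), val_comp_lift]
    refine ⟨?_, ?_⟩
    · rw [hval, ← _root_.extChartAt_source (I := I)]
      exact (extChartAt I p).map_target hut
    · rw [hval, (extChartAt I p).right_inv hut]
      exact u.2.1

/-- **The interior part of a small chart ball is preconnected** when the range of the model is
convex (e.g. a half-space or a quadrant). [folklore] -/
theorem isPreconnected_nbhd (hconv : Convex ℝ (range I)) {p : M} {ε : ℝ}
    (hε : Metric.ball (extChartAt I p p) ε ∩ range I ⊆ (extChartAt I p).target) :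
    IsPreconnected (nbhd (I := I) p ε) := by
  rw [nbhd_eq_range_param hε]
  have hc : Convex ℝ (modelSet (I := I) p ε) := (convex_ball _ _).inter hconv.interior
  haveI : PreconnectedSpace ↥(modelSet (I := I) p ε) :=
    isPreconnected_iff_preconnectedSpace.1 hc.isPreconnected
  exact isPreconnected_range (continuous_param hε)

omit [IsManifold I ∞ M] in
/-- The points of a chart ball all lie in the chart domain (definitional). [folklore] -/
theorem val_mem_source_of_mem_nbhd {p : M} {ε : ℝ} {y : InteriorManifold I M}
    (hy : y ∈ nbhd (I := I) p ε) : y.val ∈ (chartAt H p).source :=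
  hy.1

/-- **Interior points accumulate at every point**: the interior part of every chart ball about
`p` is non-empty (the range of a model with corners lies in the closure of its interior, Mathlib's
`ModelWithCorners.range_subset_closure_interior`, so there are interior chart values arbitrarily
close to the chart value of `p`). [folklore] -/
theorem nbhd_nonempty (p : M) {ε : ℝ} (hε0 : 0 < ε)
    (hε : Metric.ball (extChartAt I p p) ε ∩ range I ⊆ (extChartAt I p).target) :
    (nbhd (I := I) p ε).Nonempty := by
  have hx : extChartAt I p p ∈ range I :=
    extChartAt_target_subset_range p (mem_extChartAt_target p)
  have hcl := I.range_subset_closure_interior hx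
  rw [Metric.mem_closure_iff] at hcl
  obtain ⟨u, hu, hd⟩ := hcl ε hε0
  have hmem : u ∈ modelSet (I := I) p ε := ⟨by rwa [Metric.mem_ball, dist_comm], hu⟩
  rw [nbhd_eq_range_param hε]
  exact ⟨_, ⟨⟨u, hmem⟩, rfl⟩⟩

/-! #### The extension -/

/-- A chosen radius of a small chart ball at `p`. [folklore] -/
def rad (p : M) : ℝ := Classical.choose (exists_ball_inter_range_subset_target (I := I) p)

omit [IsManifold I ∞ M] in
/-- The chosen radius is positive. [folklore] -/
theorem rad_pos (p : M) : 0 < rad (I := I) p :=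
  (Classical.choose_spec (exists_ball_inter_range_subset_target (I := I) p)).1

omit [IsManifold I ∞ M] in
/-- The chosen chart ball lies in the chart target. [folklore] -/
theorem rad_spec (p : M) :
    Metric.ball (extChartAt I p p) (rad (I := I) p) ∩ range I ⊆ (extChartAt I p).target :=
  (Classical.choose_spec (exists_ball_inter_range_subset_target (I := I) p)).2

omit [IsManifold I ∞ M] in
/-- Smaller balls also lie in the chart target. [folklore] -/
theorem ball_subset_target_of_le {p : M} {ε : ℝ} (hε : ε ≤ rad (I := I) p) :
    Metric.ball (extChartAt I p p) ε ∩ range I ⊆ (extChartAt I p).target :=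
  (inter_subset_inter_left _ (Metric.ball_subset_ball hε)).trans (rad_spec p)

omit [IsManifold I ∞ M] in
/-- Monotonicity of the chart-ball neighbourhoods in the radius. [folklore] -/
theorem nbhd_mono {p : M} {ε ε' : ℝ} (h : ε ≤ ε') : nbhd (I := I) p ε ⊆ nbhd (I := I) p ε' :=
  fun _ hy => ⟨hy.1, Metric.ball_subset_ball h hy.2⟩

/-- **Interior points near `x` inside any neighbourhood**: every neighbourhood of `x` in `M`
contains interior points of the chosen chart ball of `x`. [folklore] -/
theorem exists_mem_nbhd_val_mem {x : M} {N : Set M} (hN : N ∈ 𝓝 x) :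
    ∃ z ∈ nbhd (I := I) x (rad (I := I) x), z.val ∈ N := by
  -- pull `N` back to the model through the inverse extended chart, continuous at the centre
  have hN' : (extChartAt I x).symm ⁻¹' N ∈ 𝓝 (extChartAt I x x) := by
    refine (continuousAt_extChartAt_symm x).preimage_mem_nhds ?_
    rwa [extChartAt_to_inv]
  obtain ⟨δ, hδ, hball⟩ := Metric.mem_nhds_iff.1 hN'
  set ε : ℝ := min δ (rad (I := I) x) with hε
  have hε0 : 0 < ε := lt_min hδ (rad_pos x)
  have hεr : ε ≤ rad (I := I) x := min_le_right _ _
  obtain ⟨z, hz⟩ := nbhd_nonempty x hε0 (ball_subset_target_of_le hεr)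
  refine ⟨z, nbhd_mono hεr hz, ?_⟩
  have hzs : z.val ∈ (extChartAt I x).source := by rw [_root_.extChartAt_source]; exact hz.1
  have h := hball (Metric.ball_subset_ball (min_le_left _ _) hz.2)
  rwa [mem_preimage, (extChartAt I x).left_inv hzs] at h

variable [FiniteDimensional ℝ E]

/-- A fixed reference orientation of the model vector space. [folklore] -/
def refOrientation : Orientation ℝ E (Fin (finrank ℝ E)) := (Module.finBasis ℝ E).orientation

/-- A chosen interior point of the chosen chart ball of `p`. [folklore] -/
def pt (p : M) : InteriorManifold I M :=
  (nbhd_nonempty p (rad_pos p) (rad_spec (I := I) p)).some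

omit [FiniteDimensional ℝ E] in
/-- The chosen interior point lies in the chosen chart ball. [folklore] -/
theorem pt_mem (p : M) : pt (I := I) p ∈ nbhd (I := I) p (rad (I := I) p) :=
  (nbhd_nonempty p (rad_pos p) (rad_spec (I := I) p)).some_mem

open Classical in
/-- **The extended orientation, pointwise**: at an interior point the given orientation of the
interior; at a boundary point `p` the reference orientation or its negative, according to the
(constant) agreement test on the interior part of the chosen chart ball of `p`. [folklore] -/
def extendFun (o : SmoothOrientation 𝓘(ℝ, E) (InteriorManifold I M)) (p : M) :
    Orientation ℝ E (Fin (finrank ℝ E)) :=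
  if hp : I.IsInteriorPoint p then o ⟨p, hp⟩
  else if Agrees o refOrientation p (pt p) then refOrientation else -refOrientation

/-- At interior points the extension is the given orientation. [folklore] -/
theorem extendFun_of_isInteriorPoint (o : SmoothOrientation 𝓘(ℝ, E) (InteriorManifold I M))
    {p : M} (hp : I.IsInteriorPoint p) : extendFun o p = o ⟨p, hp⟩ := by
  rw [extendFun, dif_pos hp]

/-- **The key property of the extension**: for every `p` and every interior point `y` of the
chosen chart ball of `p`, `o y` equals the extended value at `p` iff the chart change `y → p`
has positive Jacobian at `y`. [folklore] -/
theorem apply_eq_extendFun_iff (hconv : Convex ℝ (range I))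
    (o : SmoothOrientation 𝓘(ℝ, E) (InteriorManifold I M)) {p : M} {y : InteriorManifold I M}
    (hy : y ∈ nbhd (I := I) p (rad (I := I) p)) :
    o y = extendFun o p ↔ (Dpos I ; y.val ; p ; y.val) := by
  have hpre := isPreconnected_nbhd hconv (rad_spec (I := I) p)
  by_cases hp : I.IsInteriorPoint p
  · rw [extendFun_of_isInteriorPoint o hp]
    -- `p` itself is a point of its chart ball, where the test holds trivially
    have hpmem : (⟨p, hp⟩ : InteriorManifold I M) ∈ nbhd (I := I) p (rad (I := I) p) :=
      ⟨mem_chart_source H p, Metric.mem_ball_self (rad_pos p)⟩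
    have h := agrees_iff_of_isPreconnected o (o ⟨p, hp⟩) hpre (fun z hz => hz.1) hy hpmem
    have hself : Agrees o (o ⟨p, hp⟩) p ⟨p, hp⟩ := by
      refine iff_of_true rfl ?_
      show (0 : ℝ) < LinearMap.det ((tangentCoordChange I p p p : E →L[ℝ] E) : E →ₗ[ℝ] E)
      rw [tangentCoordChange_self_eq (mem_extChartAt_source p), ContinuousLinearMap.coe_id,
        LinearMap.det_id]
      exact zero_lt_one
    exact h.2 hself
  · have h := agrees_iff_of_isPreconnected o refOrientation hpre (fun z hz => hz.1) hy
      (pt_mem p)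
    rw [extendFun, dif_neg hp]
    by_cases ha : Agrees o refOrientation p (pt p)
    · rw [if_pos ha]; exact h.2 ha
    · rw [if_neg ha]
      have hy' : ¬ Agrees o refOrientation p y := fun h' => ha (h.1 h')
      unfold Agrees at hy'
      have hne' : (refOrientation : Orientation ℝ E (Fin (finrank ℝ E))) ≠ -refOrientation :=
        Module.Ray.ne_neg_self _
      rcases (o y).eq_or_eq_neg refOrientation (by simp) with h1 | h1
      · rw [h1] at hy' ⊢
        constructor
        · intro h2; exact absurd h2 hne'
        · intro h2; exact absurd (iff_of_true rfl h2) hy'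
      · rw [h1] at hy' ⊢
        refine iff_of_true rfl ?_
        by_contra h2
        exact hy' ⟨fun h3 => absurd h3.symm hne', fun h3 => absurd h3 h2⟩

/-- **An orientation of the interior of a manifold with boundary (or convex corners) extends to
an orientation of the manifold** (when the range of the model is convex, e.g. the half-space
`𝓡∂ n` or a quadrant): the extension `extendFun`, which agrees
with the given orientation at interior points (`extend_apply_of_isInteriorPoint`).  At a
boundary point the value is forced by the interior points of a small chart ball, which form a
connected set accumulating at the point; local constancy at boundary points is checked through
a common nearby interior point and the cocycle of chart changes.  (Orientability is decided on
the interior: Hirsch, *Differential Topology* (1976), §4.4; the boundary has measure zero in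
every chart.) [folklore] -/
def extend (hconv : Convex ℝ (range I))
    (o : SmoothOrientation 𝓘(ℝ, E) (InteriorManifold I M)) : SmoothOrientation I M where
  toFun := extendFun o
  eventually_eq_iff' p := by
    -- work inside half the chosen chart ball of `p`
    have hN : ∀ᶠ x in 𝓝 p, x ∈ (chartAt H p).source ∧
        extChartAt I p x ∈ Metric.ball (extChartAt I p p) (rad (I := I) p / 2) := by
      have h1 : ∀ᶠ x in 𝓝 p, x ∈ (chartAt H p).source :=
        (chartAt H p).open_source.mem_nhds (mem_chart_source H p)
      have h2 : ∀ᶠ x in 𝓝 p, extChartAt I p x ∈ Metric.ball (extChartAt I p p) (rad (I := I) p / 2) :=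
        (continuousAt_extChartAt p).preimage_mem_nhds (Metric.ball_mem_nhds _ (half_pos (rad_pos p)))
      exact h1.and h2
    filter_upwards [hN] with x hx
    -- an interior point `z` near `x`, in both chart balls, where the sign of the Jacobian of
    -- `x → p` is that at `x`
    have hxp : x ∈ (extChartAt I p).source := by rw [_root_.extChartAt_source]; exact hx.1
    have hNx : {m : M | m ∈ (chartAt H p).source ∧
        extChartAt I p m ∈ Metric.ball (extChartAt I p p) (rad (I := I) p) ∧
        ((Dpos I ; x ; p ; m) ↔ (Dpos I ; x ; p ; x))} ∈ 𝓝 x := by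
      have h1 : ∀ᶠ m in 𝓝 x, m ∈ (chartAt H p).source :=
        (chartAt H p).open_source.mem_nhds hx.1
      have h2 : ∀ᶠ m in 𝓝 x, extChartAt I p m ∈ Metric.ball (extChartAt I p p) (rad (I := I) p) := by
        have hc : ContinuousAt (extChartAt I p) x := continuousAt_extChartAt' hxp
        refine hc.preimage_mem_nhds (Metric.isOpen_ball.mem_nhds ?_)
        exact Metric.ball_subset_ball (by linarith [rad_pos (I := I) p]) hx.2
      have h3 := eventually_det_tangentCoordChange_pos_iff (I := I) (x₀ := x) (p := p) hx.1
      exact h1.and (h2.and h3)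
    obtain ⟨z, hzx, hzs, hzb, hzd⟩ := exists_mem_nbhd_val_mem (I := I) hNx
    have hzp : z ∈ nbhd (I := I) p (rad (I := I) p) := ⟨hzs, hzb⟩
    have kx := apply_eq_extendFun_iff hconv o hzx
    have kp := apply_eq_extendFun_iff hconv o hzp
    have hzxs : z.val ∈ (extChartAt I x).source := by rw [_root_.extChartAt_source]; exact hzx.1
    have hzps : z.val ∈ (extChartAt I p).source := by rw [_root_.extChartAt_source]; exact hzs
    have hdet := det_tangentCoordChange_pos_iff_of_mem (mem_extChartAt_source z.val) hzxs hzps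
    have htri := orientation_eq_iff_eq_iff_eq (extendFun o x) (o z) (extendFun o p)
    show extendFun o x = extendFun o p ↔ (Dpos I ; x ; p ; x)
    tauto

/-- The extended orientation at an interior point is the given one. [folklore] -/
@[simp] theorem extend_apply_of_isInteriorPoint (hconv : Convex ℝ (range I))
    (o : SmoothOrientation 𝓘(ℝ, E) (InteriorManifold I M))
    {p : M} (hp : I.IsInteriorPoint p) : extend hconv o p = o ⟨p, hp⟩ :=
  extendFun_of_isInteriorPoint o hp

/-- The extended orientation restricts back to the given orientation of the interior
(`SmoothOrientation.interior`). [folklore] -/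
theorem interior_extend (hconv : Convex ℝ (range I))
    (o : SmoothOrientation 𝓘(ℝ, E) (InteriorManifold I M)) : (extend hconv o).interior = o := by
  ext1 x
  rw [SmoothOrientation.interior_apply]
  exact extendFun_of_isInteriorPoint o x.property

end InteriorOrientation

/-! ### Orientability is decided on the interior -/

section Main

variable {E H : Type*} [NormedAddCommGroup E] [NormedSpace ℝ E] [FiniteDimensional ℝ E]
  [TopologicalSpace H] {I : ModelWithCorners ℝ E H}
  {M : Type*} [TopologicalSpace M] [ChartedSpace H M] [IsManifold I ∞ M]

/-- **A manifold with boundary (or convex corners) is orientable iff its interior is**: if the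
range of the model `I` is convex, an orientation of the boundaryless
interior manifold `InteriorManifold I M` (`InteriorManifold.lean`) extends to `M`
(`InteriorOrientation.extend`); the converse is `SmoothOrientation.interior`
(`InteriorDiscs.lean`). [folklore] -/
theorem isOrientable_iff_interiorManifold (hconv : Convex ℝ (range I)) :
    IsOrientable I M ↔ IsOrientable 𝓘(ℝ, E) (InteriorManifold I M) :=
  ⟨fun ⟨o⟩ => ⟨o.interior⟩, fun ⟨o⟩ => ⟨InteriorOrientation.extend hconv o⟩⟩

/-- **Orientability of a manifold with boundary from orientability of its interior**, for the
half-space model `𝓡∂ n` (`n ≥ 1`; its range `{x | 0 ≤ x 0}` is convex). [folklore] -/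
theorem IsOrientable.of_interiorManifold_euclideanHalfSpace {n : ℕ} [NeZero n] {W : Type*}
    [TopologicalSpace W] [ChartedSpace (EuclideanHalfSpace n) W] [IsManifold (𝓡∂ n) ∞ W]
    (h : IsOrientable 𝓘(ℝ, EuclideanSpace ℝ (Fin n)) (InteriorManifold (𝓡∂ n) W)) :
    IsOrientable (𝓡∂ n) W := by
  have hrange : range (𝓡∂ n) = {x : EuclideanSpace ℝ (Fin n) | 0 ≤ x 0} :=
    range_modelWithCornersEuclideanHalfSpace n
  refine (isOrientable_iff_interiorManifold ?_).2 h
  rw [hrange]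
  exact fun x hx y hy a b ha hb _ => by
    simp only [mem_setOf_eq, PiLp.add_apply, PiLp.smul_apply, smul_eq_mul] at hx hy ⊢
    positivity

end Main

end Literature.Topology.FourManifolds
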